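import Summits.ABC.StewartYu.PadicG3Exits
import Summits.ABC.StewartYu.RecordExitsMaster
import HarnessLib

/-!
# Cell abc-stewartyu, Gen-3 record (WP-M3.R): exit B of the END (`r = n`, Nesterenko's Lemma 5.4) is
# numerically impossible for the parameters of `PadicG3Par` — hypothesis `hB` of
# `RecordAssembly.recordTwo_of_ineqs` discharged under the instantiation convention `K ≤ N_q`

`Summits/ABC/StewartYu/PadicG3ExitBPrep.lean` — cell `abc-stewartyu` (HOME `run/shared/lean/pub/abc-stewartyu/`),
route `PadicPrimesKummerThird`, cruxes `Y07Odd` (stmt-ABC-19658) / `Y07Two` (stmt-ABC-19659); seat lp-1 (g2),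
record parcel (R2) (plan g8 2026-08-26T23:38:58Z; convention RULED 2026-08-27T01:00:18Z).  Theorems only.

Exit B is the obstruction `G* = 𝔾ₐ` (`d₀ = 1`) or `G* = {e}` (`d₀ = 0`) with the full lattice `Φ = ℤⁿ`; the
record must show `(n+1)!·2ⁿ·D₀·∏ⱼ Dⱼ < C(S₀+(n−d₀), n−d₀)·(2X_fin+1)·d₀!·D₀^{d₀}`.  With
`ρ = N_q L/2^Ŝ` (`1 ≤ ρ < L/2^{n+23}`), `Dⱼ = ⌊ρ/Aⱼ⌋ + 1`, print's case split on the largest height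
`A_{j*}` ((5.18)):

* `ρ < A_{j*}`: `D_{j*} = 1` and `Dⱼ ≤ (5/2)ρ < L/2^{n+21}`, so `∏ Dⱼ ≤ (L/2^{n+21})^{n−1}` and the `L^{n−1}`
  cancels against `S₀^{n−1}` (`S₀+1 > 16(n+1)L/(n+2)⁴`); for `d₀ = 0` the factor `D₀ ≤ X L/2` cancels
  against `2X_fin+1 > 2^{Ŝ−1}X` (print: `log(eBN)` in (5.16));
* `A_{j*} ≤ ρ`: `Dⱼ ≤ 2ρ/Aⱼ` for all `j`, `∏ Dⱼ ≤ (2ρ)ⁿ/Ω`; the `1/Ω` cancels against `L/Ω ≤ 2X·Cbⁿ·K/(3(n+1))`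
  (the second branch of `X`) for `d₀ = 1`, resp. against `D₀ ≤ 8X·Cbⁿ·Ω·K` for `d₀ = 0`, and the class
  count `K` cancels against `2^{Ŝ−1} > 2^{n+22}N_q ≥ 2^{n+22}K` — THIS is where the convention
  `K ≤ N_q` (the frame instantiates `N_q := p^m·K₀·N_sat`) is used;

and what remains is ONE comparison of constants, `RecordExitsNumeric.master`.

This file: the four `ℕ` corollaries of the master inequality, the END-degree lemmas (`ρ`, `Dⱼ`, the two
product bounds), and the cancellation lemmas; the assembly `exitB (hKNq : P.K ≤ P.Nq)` is the sequel
`PadicG3ExitB.lean`.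

WHAT THIS IS NOT: no crux moves.

References: Yu. V. Nesterenko, LNM 1819 (2003), §5.2 (5.12)–(5.18), Lemma 5.4.
-/

noncomputable section

open Finset Real Nat

namespace Summit.ABC.StewartYu

namespace PadicG3Par

open Summit.ABC.StewartYu.RecordExitsNumeric

variable {n : ℕ} (P : PadicG3Par n)

/-! ### Four `ℕ` corollaries of the master inequality -/

/-- The master inequality at `n = k+1`, shapes normalised. [cite: Nesterenko2003, §5.2 Lemma 5.4] -/
theorem master' (k : ℕ) :
    (k + 2)! * (k + 1)! * 2 ^ (k + 4) * 87 ^ (k + 1) * (k + 3) ^ (4 * (k + 1)) ≤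
      16 ^ k * (k + 2) ^ k * 2 ^ ((k + 1) ^ 2 + 21 * (k + 1) + 2) := by
  have h := master (n := k + 1) (by omega)
  simpa only [Nat.add_sub_cancel] using h

/-- Case `d₀ = 1`, `D_{j*} = 1`. [cite: Nesterenko2003, §5.2 Lemma 5.4] -/
theorem numB1i (k : ℕ) :
    (k + 2)! * k ! * 2 ^ (k + 1) * (k + 3) ^ (4 * k) ≤
      (16 * (k + 2)) ^ k * 2 ^ ((k + 22) * k) * 2 ^ (k + 24) := by
  have h := master' k
  have h1 : (k + 2)! * k ! * 2 ^ (k + 1) * (k + 3) ^ (4 * k) ≤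
      (k + 2)! * (k + 1)! * 2 ^ (k + 4) * 87 ^ (k + 1) * (k + 3) ^ (4 * (k + 1)) := by
    calc (k + 2)! * k ! * 2 ^ (k + 1) * (k + 3) ^ (4 * k)
        = (k + 2)! * k ! * 2 ^ (k + 1) * 1 * (k + 3) ^ (4 * k) := by ring
      _ ≤ (k + 2)! * (k + 1)! * 2 ^ (k + 4) * 87 ^ (k + 1) * (k + 3) ^ (4 * (k + 1)) :=
          Nat.mul_le_mul (Nat.mul_le_mul (Nat.mul_le_mul (Nat.mul_le_mul le_rfl
            (Nat.factorial_le (Nat.le_succ k))) (Nat.pow_le_pow_right (by norm_num) (by omega)))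
            (Nat.one_le_pow _ _ (by norm_num))) (Nat.pow_le_pow_right (by omega) (by omega))
  have h2 : 16 ^ k * (k + 2) ^ k * 2 ^ ((k + 1) ^ 2 + 21 * (k + 1) + 2) =
      (16 * (k + 2)) ^ k * 2 ^ ((k + 22) * k) * 2 ^ (k + 24) := by rw [mul_pow]; ring
  exact h1.trans (h.trans h2.le)

/-- Case `d₀ = 1`, all `Dⱼ ≤ 2ρ/Aⱼ`. [cite: Nesterenko2003, §5.2 Lemma 5.4] -/
theorem numB1ii (k : ℕ) :
    2 * ((k + 1)! * k ! * 2 ^ (k + 1) * (k + 3) ^ (4 * k) * 87 ^ (k + 1)) ≤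
      3 * ((16 * (k + 2)) ^ k * 2 ^ ((k + 1) * (k + 23)) * 2 ^ (k + 23)) := by
  have h := master' k
  have h1 : 2 * ((k + 1)! * k ! * 2 ^ (k + 1) * (k + 3) ^ (4 * k) * 87 ^ (k + 1)) ≤
      (k + 2)! * (k + 1)! * 2 ^ (k + 4) * 87 ^ (k + 1) * (k + 3) ^ (4 * (k + 1)) := by
    calc 2 * ((k + 1)! * k ! * 2 ^ (k + 1) * (k + 3) ^ (4 * k) * 87 ^ (k + 1))
        = (k + 1)! * k ! * 2 ^ (k + 2) * 87 ^ (k + 1) * (k + 3) ^ (4 * k) := by ring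
      _ ≤ (k + 2)! * (k + 1)! * 2 ^ (k + 4) * 87 ^ (k + 1) * (k + 3) ^ (4 * (k + 1)) :=
          Nat.mul_le_mul (Nat.mul_le_mul (Nat.mul_le_mul (Nat.mul_le_mul
            (Nat.factorial_le (Nat.le_succ _)) (Nat.factorial_le (Nat.le_succ k)))
            (Nat.pow_le_pow_right (by norm_num) (by omega))) le_rfl)
            (Nat.pow_le_pow_right (by omega) (by omega))
  have h2 : 16 ^ k * (k + 2) ^ k * 2 ^ ((k + 1) ^ 2 + 21 * (k + 1) + 2) ≤
      3 * ((16 * (k + 2)) ^ k * 2 ^ ((k + 1) * (k + 23)) * 2 ^ (k + 23)) := by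
    have hexp : (k + 1) ^ 2 + 21 * (k + 1) + 2 ≤ (k + 1) * (k + 23) + (k + 23) := by
      have e : (k + 1) * (k + 23) + (k + 23) = ((k + 1) ^ 2 + 21 * (k + 1) + 2) + (2 * k + 22) := by
        ring
      rw [e]; exact Nat.le_add_right _ _
    calc 16 ^ k * (k + 2) ^ k * 2 ^ ((k + 1) ^ 2 + 21 * (k + 1) + 2)
        ≤ 16 ^ k * (k + 2) ^ k * 2 ^ ((k + 1) * (k + 23) + (k + 23)) :=
          Nat.mul_le_mul_left _ (Nat.pow_le_pow_right (by norm_num) hexp)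
      _ = 1 * ((16 * (k + 2)) ^ k * 2 ^ ((k + 1) * (k + 23)) * 2 ^ (k + 23)) := by rw [mul_pow]; ring
      _ ≤ 3 * ((16 * (k + 2)) ^ k * 2 ^ ((k + 1) * (k + 23)) * 2 ^ (k + 23)) :=
          Nat.mul_le_mul_right _ (by norm_num)
  exact h1.trans (h.trans h2)

/-- Case `d₀ = 0`, `D_{j*} = 1`. [cite: Nesterenko2003, §5.2 Lemma 5.4] -/
theorem numB0i (k : ℕ) :
    (k + 2)! * (k + 1)! * 2 ^ k * (k + 3) ^ (4 * (k + 1)) ≤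
      (16 * (k + 2)) ^ (k + 1) * 2 ^ ((k + 22) * k) * 2 ^ (k + 24) := by
  have h := master' k
  have h1 : (k + 2)! * (k + 1)! * 2 ^ k * (k + 3) ^ (4 * (k + 1)) ≤
      (k + 2)! * (k + 1)! * 2 ^ (k + 4) * 87 ^ (k + 1) * (k + 3) ^ (4 * (k + 1)) := by
    calc (k + 2)! * (k + 1)! * 2 ^ k * (k + 3) ^ (4 * (k + 1))
        = (k + 2)! * (k + 1)! * 2 ^ k * 1 * (k + 3) ^ (4 * (k + 1)) := by ring
      _ ≤ (k + 2)! * (k + 1)! * 2 ^ (k + 4) * 87 ^ (k + 1) * (k + 3) ^ (4 * (k + 1)) :=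
          Nat.mul_le_mul (Nat.mul_le_mul (Nat.mul_le_mul le_rfl
            (Nat.pow_le_pow_right (by norm_num) (by omega))) (Nat.one_le_pow _ _ (by norm_num))) le_rfl
  have h2 : 16 ^ k * (k + 2) ^ k * 2 ^ ((k + 1) ^ 2 + 21 * (k + 1) + 2) ≤
      (16 * (k + 2)) ^ (k + 1) * 2 ^ ((k + 22) * k) * 2 ^ (k + 24) := by
    calc 16 ^ k * (k + 2) ^ k * 2 ^ ((k + 1) ^ 2 + 21 * (k + 1) + 2)
        = (16 ^ k * (k + 2) ^ k) * 1 * 2 ^ ((k + 1) ^ 2 + 21 * (k + 1) + 2) := by ring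
      _ ≤ (16 ^ k * (k + 2) ^ k) * (16 * (k + 2)) * 2 ^ ((k + 1) ^ 2 + 21 * (k + 1) + 2) :=
          Nat.mul_le_mul_right _ (Nat.mul_le_mul_left _ (by omega))
      _ = (16 * (k + 2)) ^ (k + 1) * 2 ^ ((k + 22) * k) * 2 ^ (k + 24) := by rw [mul_pow]; ring
  exact h1.trans (h.trans h2)

/-- Case `d₀ = 0`, all `Dⱼ ≤ 2ρ/Aⱼ`. [cite: Nesterenko2003, §5.2 Lemma 5.4] -/
theorem numB0ii (k : ℕ) :
    (k + 2)! * (k + 1)! * 2 ^ (k + 4) * 87 ^ (k + 1) * (k + 3) ^ (4 * (k + 1)) ≤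
      (16 * (k + 2)) ^ (k + 1) * 2 ^ ((k + 1) * (k + 23)) * 2 ^ (k + 23) := by
  have h := master' k
  have h2 : 16 ^ k * (k + 2) ^ k * 2 ^ ((k + 1) ^ 2 + 21 * (k + 1) + 2) ≤
      (16 * (k + 2)) ^ (k + 1) * 2 ^ ((k + 1) * (k + 23)) * 2 ^ (k + 23) := by
    have hexp : (k + 1) ^ 2 + 21 * (k + 1) + 2 ≤ (k + 1) * (k + 23) + (k + 23) := by
      have e : (k + 1) * (k + 23) + (k + 23) = ((k + 1) ^ 2 + 21 * (k + 1) + 2) + (2 * k + 22) := by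
        ring
      rw [e]; exact Nat.le_add_right _ _
    calc 16 ^ k * (k + 2) ^ k * 2 ^ ((k + 1) ^ 2 + 21 * (k + 1) + 2)
        ≤ 16 ^ k * (k + 2) ^ k * 2 ^ ((k + 1) * (k + 23) + (k + 23)) :=
          Nat.mul_le_mul_left _ (Nat.pow_le_pow_right (by norm_num) hexp)
      _ = (16 ^ k * (k + 2) ^ k) * 1 * 2 ^ ((k + 1) * (k + 23) + (k + 23)) := by ring
      _ ≤ (16 ^ k * (k + 2) ^ k) * (16 * (k + 2)) * 2 ^ ((k + 1) * (k + 23) + (k + 23)) :=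
          Nat.mul_le_mul_right _ (Nat.mul_le_mul_left _ (by omega))
      _ = (16 * (k + 2)) ^ (k + 1) * 2 ^ ((k + 1) * (k + 23)) * 2 ^ (k + 23) := by rw [mul_pow]; ring
  exact h.trans h2

/-! ### The END degrees: `ρ = N_q L / 2^Ŝ`, `Dⱼ = ⌊ρ/Aⱼ⌋ + 1` -/

/-- `1 ≤ ρ = N_q L/2^Ŝ` (`2^Ŝ ≤ 2^{n+24} N_q ≤ N_q L`). [cite: Nesterenko2003, §5.2 (5.6)] -/
theorem one_le_rho : (1 : ℝ) ≤ (P.Nq : ℝ) * P.L / 2 ^ P.Sdepth := by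
  have h1 : (2 : ℝ) ^ P.Sdepth ≤ 2 ^ (n + 24) * P.Nq := by exact_mod_cast P.two_pow_Sdepth_le
  have h2 : (2 : ℝ) ^ (n + 24) ≤ P.L := by exact_mod_cast P.two_pow_le_L
  have hNq : (0 : ℝ) ≤ P.Nq := by positivity
  rw [le_div_iff₀ (by positivity), one_mul]
  nlinarith

/-- `ρ < L/2^{n+23}` (`2^{n+24} N_q < 2·2^Ŝ`). [cite: Nesterenko2003, §5.2 (5.17)] -/
theorem rho_lt : (P.Nq : ℝ) * P.L / 2 ^ P.Sdepth < (P.L : ℝ) / 2 ^ (n + 23) := by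
  have hS : (2 : ℝ) ^ (n + 24) * P.Nq < 2 * 2 ^ P.Sdepth := by exact_mod_cast P.Nq_lt_two_pow
  have hL : (0 : ℝ) < P.L := by linarith [P.one_le_L]
  rw [div_lt_div_iff₀ (by positivity) (by positivity)]
  have e : (2 : ℝ) ^ (n + 24) = 2 * 2 ^ (n + 23) := by ring
  have h1 : (2 : ℝ) ^ (n + 23) * P.Nq < 2 ^ P.Sdepth := by nlinarith
  calc (P.Nq : ℝ) * P.L * 2 ^ (n + 23) = P.L * (2 ^ (n + 23) * P.Nq) := by ring
    _ < P.L * 2 ^ P.Sdepth := mul_lt_mul_of_pos_left h1 hL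

/-- `Dⱼ ≤ ρ/Aⱼ + 1`. [folklore] -/
theorem D_le_rho_div (j : Fin n) :
    (P.D j : ℝ) ≤ (P.Nq : ℝ) * P.L / 2 ^ P.Sdepth / P.A j + 1 := by
  unfold D
  push_cast
  have hA := P.A_pos j
  have h0 : 0 ≤ (P.Nq : ℝ) * P.L / (2 ^ P.Sdepth * P.A j) := by positivity
  have := Nat.floor_le h0
  rw [div_div]
  linarith

/-- `Dⱼ = 1` when `ρ < Aⱼ`. [folklore] -/
theorem D_eq_one_of_lt {j : Fin n} (h : (P.Nq : ℝ) * P.L / 2 ^ P.Sdepth < P.A j) : P.D j = 1 := by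
  unfold D
  have hA := P.A_pos j
  rw [Nat.floor_eq_zero.mpr]
  rw [← div_div, div_lt_one hA]
  exact h

/-- `Dⱼ ≤ 2ρ/Aⱼ` when `Aⱼ ≤ ρ`. [cite: Nesterenko2003, §5.2 (5.18)] -/
theorem D_le_two_rho_div {j : Fin n} (h : P.A j ≤ (P.Nq : ℝ) * P.L / 2 ^ P.Sdepth) :
    (P.D j : ℝ) ≤ 2 * ((P.Nq : ℝ) * P.L / 2 ^ P.Sdepth) / P.A j := by
  have hA := P.A_pos j
  have h1 := P.D_le_rho_div j
  have h2 : 1 ≤ (P.Nq : ℝ) * P.L / 2 ^ P.Sdepth / P.A j := by rwa [le_div_iff₀ hA, one_mul]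
  calc (P.D j : ℝ) ≤ (P.Nq : ℝ) * P.L / 2 ^ P.Sdepth / P.A j + 1 := h1
    _ ≤ (P.Nq : ℝ) * P.L / 2 ^ P.Sdepth / P.A j + (P.Nq : ℝ) * P.L / 2 ^ P.Sdepth / P.A j := by
        linarith
    _ = 2 * ((P.Nq : ℝ) * P.L / 2 ^ P.Sdepth) / P.A j := by ring

/-- `Dⱼ ≤ L/2^{n+21}` always (`Dⱼ ≤ ρ/log 2 + 1 ≤ (5/2)ρ < (5/2)L/2^{n+23}`). [cite: Nesterenko2003, §5.2 (5.17)] -/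
theorem D_le_L_div_real (j : Fin n) : (P.D j : ℝ) ≤ (P.L : ℝ) / 2 ^ (n + 21) := by
  have hA := P.A_pos j
  have hAlog := P.hA j
  have hlog2 : (2 / 3 : ℝ) ≤ Real.log 2 := by have := Real.log_two_gt_d9; linarith
  have h1 := P.D_le_rho_div j
  have hρ1 := P.one_le_rho
  have hρ := P.rho_lt
  set ρ := (P.Nq : ℝ) * P.L / 2 ^ P.Sdepth with hρdef
  have hρ0 : 0 ≤ ρ := by linarith
  -- `ρ/A_j ≤ ρ/(2/3) = (3/2) ρ`
  have h2 : ρ / P.A j ≤ (3 / 2) * ρ := by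
    rw [div_le_iff₀ hA]
    have : (2 / 3 : ℝ) ≤ P.A j := le_trans hlog2 hAlog
    nlinarith
  have hL : (0 : ℝ) < P.L := by linarith [P.one_le_L]
  have e : (P.L : ℝ) / 2 ^ (n + 21) = 4 * ((P.L : ℝ) / 2 ^ (n + 23)) := by
    rw [show (2 : ℝ) ^ (n + 23) = 2 ^ (n + 21) * 4 by ring]
    field_simp
  rw [e]
  linarith

/-! ### The products `∏ⱼ Dⱼ` in the two height cases -/

/-- Case `ρ < A_{j*}` for SOME `j*`: `∏ⱼ Dⱼ ≤ (L/2^{n+21})^{n−1}`. [cite: Nesterenko2003, §5.2 (5.18)] -/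
theorem prod_D_le_of_lt {j₀ : Fin n} (h : (P.Nq : ℝ) * P.L / 2 ^ P.Sdepth < P.A j₀) :
    (∏ j, (P.D j : ℝ)) ≤ ((P.L : ℝ) / 2 ^ (n + 21)) ^ (n - 1) := by
  classical
  have hD1 : (P.D j₀ : ℝ) = 1 := by rw [P.D_eq_one_of_lt h]; simp
  rw [← Finset.mul_prod_erase univ (fun j => (P.D j : ℝ)) (mem_univ j₀), hD1, one_mul]
  have hcard : (univ.erase j₀).card = n - 1 := by rw [card_erase_of_mem (mem_univ _), Finset.card_univ, Fintype.card_fin]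
  calc ∏ j ∈ univ.erase j₀, (P.D j : ℝ) ≤ ∏ _j ∈ univ.erase j₀, (P.L : ℝ) / 2 ^ (n + 21) :=
        prod_le_prod (fun j _ => by positivity) fun j _ => P.D_le_L_div_real j
    _ = ((P.L : ℝ) / 2 ^ (n + 21)) ^ (n - 1) := by rw [prod_const, hcard]

/-- Case `Aⱼ ≤ ρ` for ALL `j`: `Ω · ∏ⱼ Dⱼ ≤ (2ρ)ⁿ < (L/2^{n+22})ⁿ`. [cite: Nesterenko2003, §5.2 (5.18)] -/
theorem Ω_mul_prod_D_le_of_le (h : ∀ j, P.A j ≤ (P.Nq : ℝ) * P.L / 2 ^ P.Sdepth) :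
    P.Ω * ∏ j, (P.D j : ℝ) ≤ ((P.L : ℝ) / 2 ^ (n + 22)) ^ n := by
  have hρ := P.rho_lt
  set ρ := (P.Nq : ℝ) * P.L / 2 ^ P.Sdepth with hρdef
  have hρ0 : 0 ≤ ρ := by linarith [P.one_le_rho]
  have h1 : ∏ j, (P.D j : ℝ) ≤ ∏ j, (2 * ρ / P.A j) :=
    prod_le_prod (fun j _ => by positivity) fun j _ => P.D_le_two_rho_div (h j)
  have h2 : ∏ j, (2 * ρ / P.A j) = (2 * ρ) ^ n / P.Ω := by
    unfold Ω
    rw [prod_div_distrib, prod_const, Finset.card_univ, Fintype.card_fin]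
  have hΩ := P.Ω_pos
  have h3 : 2 * ρ ≤ (P.L : ℝ) / 2 ^ (n + 22) := by
    have e : (P.L : ℝ) / 2 ^ (n + 22) = 2 * ((P.L : ℝ) / 2 ^ (n + 23)) := by
      rw [show (2 : ℝ) ^ (n + 23) = 2 ^ (n + 22) * 2 by ring]; field_simp
    rw [e]; linarith
  calc P.Ω * ∏ j, (P.D j : ℝ) ≤ P.Ω * ((2 * ρ) ^ n / P.Ω) := by
        rw [← h2]; exact mul_le_mul_of_nonneg_left h1 hΩ.le
    _ = (2 * ρ) ^ n := by field_simp
    _ ≤ ((P.L : ℝ) / 2 ^ (n + 22)) ^ n := pow_le_pow_left₀ (by positivity) h3 n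

/-! ### The other cancellations -/

/-- `(3/2)(n+1)·L ≤ X · Cbⁿ Ω K` (the second branch of `X`): `L/Ω ≤ 2X·Cbⁿ·K/(3(n+1))`.
[cite: Nesterenko2003, §5.2 (5.12)] -/
theorem three_halves_mul_L_le : (3 / 2 : ℝ) * (n + 1) * P.L ≤ P.X * (Cb ^ n * P.Ω * P.K) := by
  have hpos : 0 < Cb ^ n * P.Ω * P.K := by
    have := P.Ω_pos; have := P.K_pos; have : (0 : ℝ) < Cb := by unfold Cb cM; positivity
    positivity
  have hX : (3 / 2 : ℝ) * (n + 1) * P.L / (Cb ^ n * P.Ω * P.K) ≤ P.X := by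
    have : (⌈(3 / 2 : ℝ) * (n + 1) * P.L / (Cb ^ n * P.Ω * P.K)⌉₊ : ℝ) ≤ P.X := by
      unfold X; exact_mod_cast le_max_right _ _
    exact (Nat.le_ceil _).trans this
  rwa [div_le_iff₀ hpos] at hX

/-- `D₀ ≤ 8 X · Cbⁿ Ω K` (`Cbⁿ Ω ≥ (32e·log 2)ⁿ ≥ 1`, `X, K ≥ 1`). [cite: Nesterenko2003, §5.2 (5.16)] -/
theorem D₀_le_eight : (P.D₀ : ℝ) ≤ 8 * P.X * (Cb ^ n * P.Ω * P.K) := by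
  unfold D₀ L₀
  push_cast
  have hCb1 : (2 : ℝ) ≤ Cb := by
    unfold Cb cM; have := Real.add_one_le_exp (1 : ℝ); push_cast; nlinarith
  have hCbΩ : (1 : ℝ) ≤ Cb ^ n * P.Ω := by
    have e : Cb ^ n * P.Ω = ∏ j : Fin n, (Cb * P.A j) := by
      unfold Ω; rw [prod_mul_distrib, prod_const, Finset.card_univ, Fintype.card_fin]
    rw [e]
    calc (1 : ℝ) = ∏ _j : Fin n, (1 : ℝ) := by simp
      _ ≤ ∏ j, Cb * P.A j := prod_le_prod (fun _ _ => zero_le_one) fun j _ => by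
          have := P.hA j; have := Real.log_two_gt_d9; nlinarith
  have hK : (1 : ℝ) ≤ P.K := by exact_mod_cast P.one_le_K
  have hX : (1 : ℝ) ≤ P.X := by exact_mod_cast P.one_le_X
  have h1 : (1 : ℝ) ≤ (P.X : ℝ) * (Cb ^ n * P.Ω * P.K) := by
    calc (1 : ℝ) = 1 * (1 * 1) := by ring
      _ ≤ (P.X : ℝ) * (Cb ^ n * P.Ω * P.K) := by gcongr
  have hpos : 0 ≤ 6 * (P.X : ℝ) * Cb ^ n * P.Ω * P.K := by
    have := P.Ω_pos; have := P.K_pos; positivity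
  have hceil := (Nat.ceil_lt_add_one hpos).le
  nlinarith

/-- `2^{n+22} · K < 2^{Ŝ−1}` under the convention `K ≤ N_q` (`2^{n+24} N_q < 2·2^Ŝ`). [folklore] -/
theorem two_pow_mul_K_lt (hKNq : P.K ≤ P.Nq) : 2 ^ (n + 22) * P.K < 2 ^ (P.Sdepth - 1) := by
  have h := P.Nq_lt_two_pow
  have hS : P.Sdepth = P.Sdepth - 1 + 1 := by unfold Sdepth; omega
  have e : 2 ^ P.Sdepth = 2 ^ (P.Sdepth - 1) * 2 := by
    conv_lhs => rw [hS]
    exact pow_succ 2 _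
  have h1 : 2 ^ (n + 22) * P.K ≤ 2 ^ (n + 22) * P.Nq := Nat.mul_le_mul_left _ hKNq
  have e2 : 2 ^ (n + 24) * P.Nq = 4 * (2 ^ (n + 22) * P.Nq) := by
    rw [show n + 24 = (n + 22) + 2 by omega, pow_add]; ring
  rw [e2, e] at h
  omega

/-- `2^{Ŝ−1} · X ≤ 2 · X_fin` (the points at the END). [cite: Nesterenko2003, §5.2 (5.12)] -/
theorem two_pow_mul_X_le_two_Xfin : 2 ^ (P.Sdepth - 1) * P.X ≤ 2 * P.Xfin := by
  have h := (P.X_mul_two_pow_le_Xs).trans P.Xs_le_Xfin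
  have hS : 2 ≤ P.Sdepth := by unfold Sdepth; omega
  have e : 2 ^ (P.Sdepth - 1) = 2 * 2 ^ (P.Sdepth - 2) := by
    rw [← pow_succ']; congr 1; omega
  rw [e]
  calc 2 * 2 ^ (P.Sdepth - 2) * P.X = 2 * (P.X * 2 ^ (P.Sdepth - 2)) := by ring
    _ ≤ 2 * P.Xfin := Nat.mul_le_mul_left _ h

/-- `2^{n+23} ≤ 2^{Ŝ−1}`. [folklore] -/
theorem two_pow_le_two_pow_Sdepth_pred : 2 ^ (n + 23) ≤ 2 ^ (P.Sdepth - 1) :=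
  Nat.pow_le_pow_right (by norm_num) (by unfold Sdepth; omega)

/-- `Cb ≤ 87` (`Cb = 32e`). [folklore] -/
theorem Cb_le : Cb ≤ (87 : ℝ) := by
  unfold Cb cM; have := Real.exp_one_lt_d9; push_cast; nlinarith

/-- `16(n+1)L < (S₀+1)(n+2)⁴` in `ℝ`. [cite: Nesterenko2003, §5.2 (5.8)] -/
theorem sixteen_mul_L_lt : (16 : ℝ) * (n + 1) * P.L < ((P.S₀N : ℝ) + 1) * ((n : ℝ) + 2) ^ 4 := by
  exact_mod_cast P.M_lt_S₀N_succ_mul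

end PadicG3Par

end Summit.ABC.StewartYu

end
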